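import Summits.NavierStokesRegularity.NavierStokesRegularity.Theorems.HubbleDynamoNoSelfExcitedDynamoReduction
import Literature.Analysis.FluidPDE.ChaeWolfRemovingDSSProofs
import HarnessLib

/-!
# Crux `NoSelfExcitedDynamo` (stmt-NavierStokesRegularity-1934), line `registered`: the small-period
  DSS rung is a theorem (Chae–Wolf 2017, Thm 1.3)

Theorems file (lands `--supports stmt-NavierStokesRegularity-1934`; registered known-case rung
`rung_dssSmallPeriod`). The crux is reduced (landed, `stub_eternalReduction`) to the non-existence of
nontrivial eternal classical solutions `(W, Q)` of Leray's backward system on `ℝ × ℝ³`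
(`IsBackwardLeraySolutionOn univ 1 W Q`) in the uniform profile class. This file records a KNOWN
case inside that open statement: for every profile constant `K₀ > 0` there is a threshold
`L₀ = L₀(K₀) > 0` such that every eternal profile-class solution with `(1 + ‖y‖)‖W(s, y)‖ ≤ K₀`
which is PERIODIC in `s` with a SMALL period `0 < L < L₀` vanishes identically. Indeed its physical
field `u = ofLerayOrbit W` is a classical solution on `(−∞, 0)` with the pointwise Type-I bound
`‖u(t, x)‖ ≤ K₀/(‖x‖ + √(−t))` (the tree's dictionary `isClassicalNSSolutionOn_Iio_ofLerayOrbit_iff`,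
`hasTypeIDecay_iff_lerayOrbit`), and `L`-periodicity of the profile is `λ`-discrete self-similarity
of `u` with `λ = e^{L/2}` (`periodic_lerayOrbit_iff`); for `λ ∈ (1, λ_*(K₀))` such fields vanish by
Chae–Wolf 2017, Theorem 1.3, PROVED in the tree (`chaeWolf2017_removing_dss_holds`). Take
`L₀ := 2 log λ_*`. Steady profiles (Leray / Nečas–Růžička–Šverák / Tsai) are the case "periodic with
every period".
-/

noncomputable section

-- the mandated stub namespace repeats `NavierStokesRegularity` (tree precedent for this crux's stubs)
set_option linter.dupNamespace false

namespace Summit.NavierStokesRegularity.NavierStokesRegularity.Theorems.NoSelfExcitedDynamo.Registered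

open Set MeasureTheory Filter Topology
open scoped ContDiff
open Literature.Analysis.FluidPDE

/-- The physical field of a profile is junk (`= 0`) at non-negative times: `√(−t) = 0` for `0 ≤ t`
and `0⁻¹ = 0`, so `ofLerayOrbit U t x = 0 • _ = 0`. -/
theorem rungDss_ofLerayOrbit_eq_zero_of_nonneg
    (U : ℝ → EuclideanSpace ℝ (Fin 3) → EuclideanSpace ℝ (Fin 3)) {t : ℝ} (ht : 0 ≤ t)
    (x : EuclideanSpace ℝ (Fin 3)) : ofLerayOrbit U t x = 0 := by
  rw [ofLerayOrbit_apply, Real.sqrt_eq_zero'.2 (neg_nonpos.2 ht), inv_zero, zero_smul]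

/-- **Periodic profile ⇒ discretely self-similar physical field (on all of `ℝ`).** If the profile
`W` is `L`-periodic in `s` (`0 < L`), then `u = ofLerayOrbit W` is `e^{L/2}`-DSS as a function on
`ℝ × ℝ³`: on the past this is `periodic_lerayOrbit_iff` with `lerayOrbit (ofLerayOrbit W) = W` and
`2 log e^{L/2} = L`; at non-negative times both sides are the junk value `0`. -/
theorem rungDss_isDiscretelySelfSimilar_ofLerayOrbit
    {W : ℝ → EuclideanSpace ℝ (Fin 3) → EuclideanSpace ℝ (Fin 3)} {L : ℝ}
    (hper : ∀ s y, W (s + L) y = W s y) :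
    IsDiscretelySelfSimilar (Real.exp (L / 2)) (ofLerayOrbit W) := by
  -- adapted from `polyhedralDssProfileExists_of_periodicLerayOrbit`
  -- (Theorems/QuantisedSymmetryPolyhedralDssProfileExistsLerayOrbitOfProfile.lean)
  have hc0 : 0 < Real.exp (L / 2) := Real.exp_pos _
  have hlogc : 2 * Real.log (Real.exp (L / 2)) = L := by rw [Real.log_exp]; ring
  have hper' : Function.Periodic (lerayOrbit (ofLerayOrbit W)) (2 * Real.log (Real.exp (L / 2))) := by
    rw [lerayOrbit_ofLerayOrbit_eq, hlogc]
    exact fun s => funext fun y => hper s y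
  have hpast := (periodic_lerayOrbit_iff hc0).1 hper'
  funext t x
  by_cases ht : t < 0
  · exact congrFun (hpast t ht) x
  · -- junk region `t ≥ 0`: both sides vanish
    have ht' : 0 ≤ t := not_lt.1 ht
    rw [nsRescale_apply, rungDss_ofLerayOrbit_eq_zero_of_nonneg W (mul_nonneg (sq_nonneg _) ht'),
      rungDss_ofLerayOrbit_eq_zero_of_nonneg W ht', smul_zero]

/-- **The small-period DSS rung of the crux** (registered known-case rung `rung_dssSmallPeriod`;
Chae–Wolf 2017, Thm 1.3, proved in the tree as `chaeWolf2017_removing_dss_holds`): for every profile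
constant `K₀ > 0` there is `L₀ > 0` such that every eternal classical solution `(W, Q)` of Leray's
backward system on `ℝ × ℝ³` with `(1 + ‖y‖)‖W(s, y)‖ ≤ K₀` which is `L`-periodic in `s` for some
`0 < L < L₀` is identically zero. Proof: with `λ_* = λ_*(K₀) > 1` from Chae–Wolf take
`L₀ := 2 log λ_*`; for `0 < L < L₀` the factor `λ := e^{L/2}` lies in `(1, λ_*)`, the physical field
`u = ofLerayOrbit W` is classical on `(−∞, 0)` (`isClassicalNSSolutionOn_Iio_ofLerayOrbit_iff`),
Type-I with constant `K₀` (`hasTypeIDecay_iff_lerayOrbit`, `lerayOrbit_ofLerayOrbit_eq`) and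
`λ`-DSS (`rungDss_isDiscretelySelfSimilar_ofLerayOrbit`), so `u ≡ 0` on `t < 0`, whence
`W = lerayOrbit u ≡ 0`. -/
theorem rung_dssSmallPeriod :
    ∀ K₀ : ℝ, 0 < K₀ → ∃ L₀ : ℝ, 0 < L₀ ∧
      ∀ (W : ℝ → EuclideanSpace ℝ (Fin 3) → EuclideanSpace ℝ (Fin 3)) (Q : ℝ → EuclideanSpace ℝ (Fin 3) → ℝ),
        IsBackwardLeraySolutionOn univ 1 W Q → (∀ s y, (1 + ‖y‖) * ‖W s y‖ ≤ K₀) →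
        ∀ L : ℝ, 0 < L → L < L₀ → (∀ s y, W (s + L) y = W s y) → ∀ s y, W s y = 0 := by
  intro K₀ hK₀
  obtain ⟨c₁, hc₁, hfact⟩ := chaeWolf2017_removing_dss_holds K₀ hK₀
  refine ⟨2 * Real.log c₁, mul_pos two_pos (Real.log_pos hc₁), ?_⟩
  intro W Q hW hK L hL hLL₀ hper s y
  -- the DSS factor `λ = e^{L/2} ∈ (1, c₁)`
  have h1c : 1 < Real.exp (L / 2) := Real.one_lt_exp_iff.2 (by linarith)
  have hcc₁ : Real.exp (L / 2) < c₁ := by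
    calc Real.exp (L / 2) < Real.exp (Real.log c₁) := Real.exp_lt_exp.2 (by linarith)
      _ = c₁ := Real.exp_log (zero_lt_one.trans hc₁)
  -- physical variables: classical on `(−∞, 0)`, Type-I with constant `K₀`, `e^{L/2}`-DSS
  have hcl : IsClassicalNSSolutionOn (Iio 0) 1 0 (ofLerayOrbit W) (ofLerayOrbitPressure Q) :=
    isClassicalNSSolutionOn_Iio_ofLerayOrbit_iff.2 hW
  have hU : lerayOrbit (ofLerayOrbit W) = W := lerayOrbit_ofLerayOrbit_eq W
  have hdec : HasTypeIDecay K₀ (ofLerayOrbit W) :=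
    hasTypeIDecay_iff_lerayOrbit.2 (by rw [hU]; exact hK)
  have hdss : IsDiscretelySelfSimilar (Real.exp (L / 2)) (ofLerayOrbit W) :=
    rungDss_isDiscretelySelfSimilar_ofLerayOrbit hper
  -- Chae–Wolf 2017, Thm 1.3: the physical field vanishes on the past, hence so does its profile
  have hzero : ∀ t < 0, ∀ x, ofLerayOrbit W t x = 0 :=
    hfact (Real.exp (L / 2)) h1c hcc₁ (ofLerayOrbit W) (ofLerayOrbitPressure Q) hcl hdss hdec
  have e : W s y = lerayOrbit (ofLerayOrbit W) s y := by rw [hU]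
  rw [e, lerayOrbit_apply, hzero _ (neg_exp_neg_lt_zero s), smul_zero]

end Summit.NavierStokesRegularity.NavierStokesRegularity.Theorems.NoSelfExcitedDynamo.Registered

end
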